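/-
Copyright (c) 2026. All rights reserved.
Released under Apache 2.0 license as described in the file LICENSE.
-/
import Literature.MathematicalPhysics.QuantumLattice.HartreeFockBlochMixtureTTPrime
import Literature.MathematicalPhysics.QuantumLattice.HartreeFockQuasiFreeCertificate
import HarnessLib

/-!
# Translation-invariant quasi-free certificates for the `t–t'` Hubbard model: the exact cell energy
# with the DIAGONAL bonds, and the soundness theorem (one certificate = one cap PLANE in `(t, t', U)`)

Topic `MathematicalPhysics/QuantumLattice`, family `hubbard`; the `t' ≠ 0` continuation of
`HartreeFockQuasiFreeCertificate.lean` (deliberately `t' = 0` there), over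
`HartreeFockBlochTorusTTPrime.lean` / `HartreeFockBlochMixtureTTPrime.lean`. A certificate is, as
before, a superlattice-periodic one-body kernel: a cell `Π_i ℤ/(M i)ℤ`, a finite symmetric support
`S ⊂ ℤ²`, matrices `γ_σ(R)` (`R ∈ S`) with `γ_σ(-R) = γ_σ(R)ᴴ`, Frobenius bounds of the integer defect
kernel and the three rational shrink inequalities; its Bloch blocks are `kernelBlock S γ κ`. NEW here is
only the diagonal-bond slot of the exact cell energy:

* **`qfCellDiag γ`** `= Σ_σ Σ_{x̄} [γ_σ(s₀+s₁)(x̄+e₀+e₁, x̄) + γ_σ(-(s₀+s₁))(x̄, x̄+e₀+e₁)`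
  `                    + γ_σ(s₀-s₁)(x̄+e₀, x̄+e₁) + γ_σ(s₁-s₀)(x̄+e₁, x̄+e₀)]`
  (`sᵢ = faceShift M i x̄ ∈ {0, -eᵢ}`: a diagonal bond leaving the cell through face `i` reads the
  kernel at the neighbouring supercell), and **`blochDiag_kernelBlock`**: `blochDiag Q = |k| · qfCellDiag γ`
  (no aliasing — the tree's `NoAlias` already quantifies over all shifts with coordinates in `{0,±1}`,
  so the diagonal shifts are covered);
* **`qfCellEnergyTT' t t' U γ`** `= qfCellEnergy t U γ - t' · qfCellDiag γ`, and its real part as an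
  AFFINE function of `(t, t', U)` for a fixed kernel (`qfCellEnergyTT'_re`);
* **`energyDensityTT'_le_qfCellEnergyTT'_add`** (fixed cell counts, `+ (16|t| + 32|t'|)/L`) and
  **`energyDensityTT'_le_qfCellEnergyTT'`** (`L → ∞` along `m k₀`):
  `e(t, t', U; re Σ_σ tr γ_σ(0)/|cell|) ≤ re qfCellEnergyTT' t t' U γ / |cell|` under EXACTLY the
  hypotheses of the tree's `energyDensity2D_le_qfCellEnergy` (FORMAT-qf1 reader duties), for all real
  `t, t'` and `U ≥ 0`;
* **`energyDensityTT'_le_qfPlane`** — the same with the three cell numbers named: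
  `e(t,t',U,n̄) ≤ t·K - t'·K_d + U·D` for ALL `t, t'` and ALL `U ≥ 0`, where
  `K = re qfCellEnergy 1 0 γ/|cell|`, `K_d = re qfCellDiag γ/|cell|`, `D = re qfCellEnergy 0 1 γ/|cell|`:
  ONE certificate is a cap PLANE over the whole `(t', U ≥ 0)` half-plane at its density (the
  `t'`-transport of certified quasi-free upper bounds needs no new solve).

Everything is proved; the definitions (`qfCellDiag`, `qfCellEnergyTT'`) have bodies; no named facts.

## Mathlib / tree search

Tree (REUSED): `kernelBlock`, `NoAlias`, `cellVec`, `faceShift`, `qfCellEnergy`, `blochEnergy_kernelBlock`,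
`sum_trace_kernelBlock`, `isHermitian_kernelBlock`, `defectSupport`, `defectKernel`, `shrinkKernel`,
`shrinkKernel_eq_zero`, `kernelBlock_shrinkKernel_posSemidef` (`HartreeFockQuasiFreeCertificate`);
`blochDiag`, `blochEnergyTT'` (`HartreeFockBlochTorusTTPrime`); `energyDensityTT'_le_blochTT'_of_posSemidef`
(`HartreeFockBlochMixtureTTPrime`); `facePhase`, `blockChar_add_right`, `blockChar_neg_right`,
`sum_blockChar_left`, `card_cells_ne_zero` (`HartreeFockBlochTorus`). The `cellVec`/`faceShift`
bookkeeping lemmas of the `t' = 0` file are private there and re-proved here.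
`lean search 'qfCellEnergyTT|qfCellDiag'`: nothing.

## References

* V. Bach, E. H. Lieb, J. P. Solovej, *Generalized Hartree–Fock theory and the Hubbard model*,
  J. Stat. Phys. 76 (1994) 3, eqs. (2c.4), (2c.8), (2c.36), (3a.2). [BachLiebSolovej1994]
* E. H. Lieb, *Variational principle for many-fermion systems*, PRL 46 (1981) 457. [Lieb1981]
-/

noncomputable section

namespace Literature.MathematicalPhysics.QuantumLattice

namespace HartreeFock

open Matrix Finset Literature.Probability.LatticeModels HeisenbergTL
open scoped ComplexConjugate ComplexOrder

/-! ### Bookkeeping: `cellVec`, `faceShift`, character orthogonality against the kernel -/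

section Kernel

variable {d : ℕ} {k M : Fin d → ℕ} [∀ i, NeZero (k i)] [∀ i, NeZero (M i)]

omit [∀ i, NeZero (k i)] in
/-- `cellVec` is additive. [folklore] -/
private theorem cellVec_add (R T : Fin d → ℤ) : cellVec k (R + T) = cellVec k R + cellVec k T := by
  funext i; simp [cellVec]

omit [∀ i, NeZero (k i)] in
/-- `cellVec` is odd. [folklore] -/
private theorem cellVec_neg (R : Fin d → ℤ) : cellVec k (-R) = -cellVec k R := by
  funext i; simp [cellVec]

omit [∀ i, NeZero (k i)] in
/-- `cellVec` of a difference. [folklore] -/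
private theorem cellVec_sub (R T : Fin d → ℤ) : cellVec k (R - T) = cellVec k R - cellVec k T := by
  funext i; simp [cellVec]

omit [∀ i, NeZero (k i)] in
/-- `cellVec 0 = 0`. [folklore] -/
private theorem cellVec_zero : cellVec k (0 : Fin d → ℤ) = 0 := by
  funext i; simp [cellVec]

omit [∀ i, NeZero (k i)] in
/-- `cellVec eᵢ = eᵢ`. [folklore] -/
private theorem cellVec_single (i : Fin d) : cellVec k (Pi.single i (1 : ℤ)) = Pi.single i 1 := by
  funext j
  by_cases h : j = i
  · subst h; simp [cellVec]
  · simp [cellVec, Pi.single_eq_of_ne h]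

/-- **Character orthogonality against the kernel**: for `f` vanishing outside `S` and `v` with
coordinates in `{0, ±1}`, `Σ_{R ∈ S} f(R) Σ_κ χ_κ(R̄ - v̄) = |k| f(v)` (no aliasing). [folklore] -/
private theorem sum_mul_sum_blockChar_cellVec_sub {S : Finset (Fin d → ℤ)} (hS : NoAlias k S)
    {f : (Fin d → ℤ) → ℂ} (hf : ∀ R ∉ S, f R = 0) {v : Fin d → ℤ}
    (hv : ∀ j, v j = 0 ∨ v j = 1 ∨ v j = -1) :
    ∑ R ∈ S, f R * ∑ κ : RectTorusSite k, blockChar κ (cellVec k (R - v)) =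
      (Fintype.card (RectTorusSite k) : ℂ) * f v := by
  have hterm : ∀ R ∈ S, f R * ∑ κ : RectTorusSite k, blockChar κ (cellVec k (R - v)) =
      if R = v then (Fintype.card (RectTorusSite k) : ℂ) * f R else 0 := by
    intro R hR
    rw [sum_blockChar_left]
    by_cases h : R = v
    · subst h; rw [sub_self, cellVec_zero, if_pos rfl, if_pos rfl, mul_comm]
    · rw [if_neg (fun h0 => h (hS R hR v hv h0)), if_neg h, mul_zero]
  rw [Finset.sum_congr rfl hterm, Finset.sum_ite_eq']
  split_ifs with h
  · rfl
  · rw [hf v h, mul_zero]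

omit [∀ i, NeZero (M i)] in
/-- `θ_κ,i(p) · χ_κ(R̄) = χ_κ(R̄ - faceShift̄)`. [folklore] -/
private theorem facePhase_mul_blockChar (κ : RectTorusSite k) (i : Fin d) (p : RectTorusSite M)
    (R : Fin d → ℤ) :
    facePhase κ i p * blockChar κ (cellVec k R) = blockChar κ (cellVec k (R - faceShift M i p)) := by
  unfold facePhase faceShift
  split_ifs
  · simp
  · rw [sub_neg_eq_add, cellVec_add, cellVec_single, blockChar_add_right, mul_comm]

omit [∀ i, NeZero (M i)] in
/-- `conj θ_κ,i(p) · χ_κ(R̄) = χ_κ(R̄ + faceShift̄)`. [folklore] -/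
private theorem conj_facePhase_mul_blockChar (κ : RectTorusSite k) (i : Fin d) (p : RectTorusSite M)
    (R : Fin d → ℤ) :
    conj (facePhase κ i p) * blockChar κ (cellVec k R) =
      blockChar κ (cellVec k (R + faceShift M i p)) := by
  unfold facePhase faceShift
  split_ifs
  · simp
  · rw [← sub_eq_add_neg, cellVec_sub, cellVec_single, blockChar_sub_right, mul_comm]

omit [∀ i, NeZero (k i)] [∀ i, NeZero (M i)] in
/-- The coordinate `j` of `faceShift M i p` is `0`, or `-1` with `j = i`. [folklore] -/
private theorem faceShift_apply (i : Fin d) (p : RectTorusSite M) (j : Fin d) :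
    faceShift M i p j = 0 ∨ (faceShift M i p j = -1 ∧ j = i) := by
  unfold faceShift
  split_ifs
  · exact Or.inl rfl
  · by_cases h : j = i
    · subst h; exact Or.inr ⟨by simp, rfl⟩
    · exact Or.inl (by simp [Pi.single_eq_of_ne h])

end Kernel

/-! ### The diagonal-bond slot of the exact cell energy -/

section Diag

variable {k M : Fin 2 → ℕ} [∀ i, NeZero (k i)] [∀ i, NeZero (M i)]

/-- **The exact diagonal-bond sum of a quasi-free certificate** (two-dimensional cell;
`sᵢ = faceShift M i x̄ ∈ {0, -eᵢ}` records whether the bond leaves the cell through face `i`):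
`Σ_σ Σ_{x̄} [γ_σ(s₀+s₁)(x̄+e₀+e₁, x̄) + γ_σ(-(s₀+s₁))(x̄, x̄+e₀+e₁) + γ_σ(s₀-s₁)(x̄+e₀, x̄+e₁)`
`+ γ_σ(s₁-s₀)(x̄+e₁, x̄+e₀)]` — the one-body Wick term of the diagonal hopping in the quasi-free state
of kernel `γ`, per cell. [cite: BachLiebSolovej1994, eq. (2c.8)] -/
def qfCellDiag (γ : Fin 2 → (Fin 2 → ℤ) → Matrix (RectTorusSite M) (RectTorusSite M) ℂ) : ℂ :=
  ∑ σ, ∑ p : RectTorusSite M,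
    (γ σ (faceShift M 0 p + faceShift M 1 p) (p + Pi.single 0 1 + Pi.single 1 1) p +
      γ σ (-(faceShift M 0 p + faceShift M 1 p)) p (p + Pi.single 0 1 + Pi.single 1 1) +
      γ σ (faceShift M 0 p - faceShift M 1 p) (p + Pi.single 0 1) (p + Pi.single 1 1) +
      γ σ (faceShift M 1 p - faceShift M 0 p) (p + Pi.single 1 1) (p + Pi.single 0 1))

/-- **The exact cell energy of a quasi-free certificate in the `t–t'` Hubbard model**:
`qfCellEnergyTT' t t' U γ = qfCellEnergy t U γ - t' · qfCellDiag γ` (nearest-neighbour bonds,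
diagonal bonds, on-site direct term). [cite: BachLiebSolovej1994, eq. (2c.8)] -/
def qfCellEnergyTT' (t t' U : ℝ)
    (γ : Fin 2 → (Fin 2 → ℤ) → Matrix (RectTorusSite M) (RectTorusSite M) ℂ) : ℂ :=
  qfCellEnergy t U γ - (t' : ℂ) * qfCellDiag γ

omit [∀ i, NeZero (k i)] in
/-- **The real cell energy is affine in `(t, t', U)` for a fixed kernel**:
`re qfCellEnergyTT' t t' U γ = t · re qfCellEnergy 1 0 γ - t' · re qfCellDiag γ + U · re qfCellEnergy 0 1 γ`
(`qfCellEnergy 1 0 γ` is minus the nearest-neighbour bond sum, `qfCellEnergy 0 1 γ` the on-site direct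
term). [cite: BachLiebSolovej1994, eq. (2c.8)] -/
theorem qfCellEnergyTT'_re (t t' U : ℝ)
    (γ : Fin 2 → (Fin 2 → ℤ) → Matrix (RectTorusSite M) (RectTorusSite M) ℂ) :
    (qfCellEnergyTT' t t' U γ).re =
      t * (qfCellEnergy 1 0 γ).re - t' * (qfCellDiag γ).re + U * (qfCellEnergy 0 1 γ).re := by
  unfold qfCellEnergyTT' qfCellEnergy
  simp only [Complex.sub_re, Complex.add_re, Complex.mul_re, Complex.neg_re, Complex.neg_im,
    Complex.ofReal_re, Complex.ofReal_im, Complex.ofReal_one, Complex.ofReal_zero, Complex.one_re,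
    Complex.one_im, neg_zero, zero_mul, one_mul, sub_zero, add_zero, zero_add]
  ring

variable (S : Finset (Fin 2 → ℤ)) (γ : (Fin 2 → ℤ) → Matrix (RectTorusSite M) (RectTorusSite M) ℂ)

omit [∀ i, NeZero (M i)] in
/-- Entries of a block. [folklore] -/
private theorem kernelBlock_apply (κ : RectTorusSite k) (p q : RectTorusSite M) :
    kernelBlock S γ κ p q = ∑ R ∈ S, blockChar κ (cellVec k R) * γ R p q := by
  simp [kernelBlock, Matrix.sum_apply]

omit [∀ i, NeZero (k i)] [∀ i, NeZero (M i)] in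
/-- The four diagonal shifts `±(s₀ + s₁)`, `±(s₀ - s₁)` have coordinates in `{0, ±1}`. [folklore] -/
private theorem diagShift_coord (p : RectTorusSite M) (ε₀ ε₁ : ℤ) (h₀ : ε₀ = 1 ∨ ε₀ = -1)
    (h₁ : ε₁ = 1 ∨ ε₁ = -1) (j : Fin 2) :
    (ε₀ • faceShift M 0 p + ε₁ • faceShift M 1 p) j = 0 ∨
      (ε₀ • faceShift M 0 p + ε₁ • faceShift M 1 p) j = 1 ∨
      (ε₀ • faceShift M 0 p + ε₁ • faceShift M 1 p) j = -1 := by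
  simp only [Pi.add_apply, Pi.smul_apply, smul_eq_mul]
  rcases faceShift_apply (M := M) 0 p j with h0 | ⟨h0, hj0⟩ <;>
    rcases faceShift_apply (M := M) 1 p j with h1 | ⟨h1, hj1⟩
  · left; rw [h0, h1]; ring
  · rw [h0, h1]; rcases h₁ with rfl | rfl <;> norm_num
  · rw [h0, h1]; rcases h₀ with rfl | rfl <;> norm_num
  · exact absurd (hj0.symm.trans hj1) (by decide)

/-- **The diagonal-bond cell expression of the kernel blocks is `|k|` times the exact diagonal-bond
sum** (no aliasing; `γ_σ` vanishing outside `S`): `blochDiag (kernelBlock S γ_σ) = |k| · qfCellDiag γ`.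
[cite: BachLiebSolovej1994, eq. (3a.2)] -/
theorem blochDiag_kernelBlock (hS : NoAlias k S)
    (γ : Fin 2 → (Fin 2 → ℤ) → Matrix (RectTorusSite M) (RectTorusSite M) ℂ)
    (hγS : ∀ σ, ∀ R ∉ S, γ σ R = 0) :
    blochDiag (fun σ => kernelBlock (k := k) S (γ σ)) =
      (Fintype.card (RectTorusSite k) : ℂ) * qfCellDiag γ := by
  set c : ℂ := (Fintype.card (RectTorusSite k) : ℂ) with hc
  rw [blochDiag, qfCellDiag]
  -- the four bond families of a fixed `(σ, p)`, summed over `κ`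
  have hbond : ∀ (σ : Fin 2) (p : RectTorusSite M) (a b : RectTorusSite M) (φ : RectTorusSite k → ℂ)
      (v : Fin 2 → ℤ) (hv : ∀ j, v j = 0 ∨ v j = 1 ∨ v j = -1)
      (hφ : ∀ κ R, φ κ * blockChar κ (cellVec k R) = blockChar κ (cellVec k (R - v))),
      ∑ κ : RectTorusSite k, φ κ * kernelBlock S (γ σ) κ a b = c * γ σ v a b := by
    intro σ p a b φ v hv hφ
    simp_rw [kernelBlock_apply, Finset.mul_sum, ← mul_assoc, hφ]
    rw [Finset.sum_comm]
    simp_rw [← Finset.sum_mul]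
    have h := sum_mul_sum_blockChar_cellVec_sub (k := k) hS (f := fun R => γ σ R a b)
      (fun R hR => by rw [hγS σ R hR]; rfl) hv
    rw [← h]
    exact Finset.sum_congr rfl fun R _ => mul_comm _ _
  -- the phase identities of the four families
  have hφ1 : ∀ (p : RectTorusSite M) (κ : RectTorusSite k) (R : Fin 2 → ℤ),
      facePhase κ 0 p * facePhase κ 1 p * blockChar κ (cellVec k R) =
        blockChar κ (cellVec k (R - (faceShift M 0 p + faceShift M 1 p))) := by
    intro p κ R
    rw [mul_assoc, facePhase_mul_blockChar, facePhase_mul_blockChar, sub_sub, add_comm]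
  have hφ2 : ∀ (p : RectTorusSite M) (κ : RectTorusSite k) (R : Fin 2 → ℤ),
      conj (facePhase κ 0 p * facePhase κ 1 p) * blockChar κ (cellVec k R) =
        blockChar κ (cellVec k (R - -(faceShift M 0 p + faceShift M 1 p))) := by
    intro p κ R
    rw [map_mul, mul_assoc, conj_facePhase_mul_blockChar, conj_facePhase_mul_blockChar, sub_neg_eq_add,
      add_assoc, add_comm (faceShift M 1 p)]
  have hφ3 : ∀ (p : RectTorusSite M) (κ : RectTorusSite k) (R : Fin 2 → ℤ),
      facePhase κ 0 p * conj (facePhase κ 1 p) * blockChar κ (cellVec k R) =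
        blockChar κ (cellVec k (R - (faceShift M 0 p - faceShift M 1 p))) := by
    intro p κ R
    rw [mul_assoc, conj_facePhase_mul_blockChar, facePhase_mul_blockChar]
    congr 2
    abel
  have hφ4 : ∀ (p : RectTorusSite M) (κ : RectTorusSite k) (R : Fin 2 → ℤ),
      conj (facePhase κ 0 p) * facePhase κ 1 p * blockChar κ (cellVec k R) =
        blockChar κ (cellVec k (R - (faceShift M 1 p - faceShift M 0 p))) := by
    intro p κ R
    rw [mul_assoc, facePhase_mul_blockChar, conj_facePhase_mul_blockChar]
    congr 2
    abel
  -- coordinates of the four shifts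
  have hv1 : ∀ p : RectTorusSite M, ∀ j, (faceShift M 0 p + faceShift M 1 p) j = 0 ∨
      (faceShift M 0 p + faceShift M 1 p) j = 1 ∨ (faceShift M 0 p + faceShift M 1 p) j = -1 := by
    intro p j
    have h := diagShift_coord p 1 1 (Or.inl rfl) (Or.inl rfl) j
    simpa only [one_smul] using h
  have hv2 : ∀ p : RectTorusSite M, ∀ j, (-(faceShift M 0 p + faceShift M 1 p)) j = 0 ∨
      (-(faceShift M 0 p + faceShift M 1 p)) j = 1 ∨ (-(faceShift M 0 p + faceShift M 1 p)) j = -1 := by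
    intro p j
    have h := diagShift_coord p (-1) (-1) (Or.inr rfl) (Or.inr rfl) j
    simpa only [neg_smul, one_smul, neg_add] using h
  have hv3 : ∀ p : RectTorusSite M, ∀ j, (faceShift M 0 p - faceShift M 1 p) j = 0 ∨
      (faceShift M 0 p - faceShift M 1 p) j = 1 ∨ (faceShift M 0 p - faceShift M 1 p) j = -1 := by
    intro p j
    have h := diagShift_coord p 1 (-1) (Or.inl rfl) (Or.inr rfl) j
    simpa only [one_smul, neg_smul, ← sub_eq_add_neg] using h
  have hv4 : ∀ p : RectTorusSite M, ∀ j, (faceShift M 1 p - faceShift M 0 p) j = 0 ∨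
      (faceShift M 1 p - faceShift M 0 p) j = 1 ∨ (faceShift M 1 p - faceShift M 0 p) j = -1 := by
    intro p j
    have h := diagShift_coord p (-1) 1 (Or.inr rfl) (Or.inl rfl) j
    simpa only [one_smul, neg_smul, neg_add_eq_sub] using h
  rw [Finset.mul_sum]
  refine Finset.sum_congr rfl fun σ _ => ?_
  rw [Finset.sum_comm, Finset.mul_sum]
  refine Finset.sum_congr rfl fun p _ => ?_
  rw [Finset.sum_add_distrib, Finset.sum_add_distrib, Finset.sum_add_distrib,
    hbond σ p _ _ _ _ (hv1 p) (hφ1 p), hbond σ p _ _ _ _ (hv2 p) (hφ2 p),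
    hbond σ p _ _ _ _ (hv3 p) (hφ3 p), hbond σ p _ _ _ _ (hv4 p) (hφ4 p)]
  ring

end Diag

/-! ### The certificate theorem: fixed cell counts, then the thermodynamic limit -/

section Certificate

variable {L : ℕ} [NeZero L] {k M : Fin 2 → ℕ} [∀ i, NeZero (k i)] [∀ i, NeZero (M i)]

omit [NeZero L] in
/-- `|cells| · |cell| = L²`. [folklore] -/
private theorem card_cells_mul_card_cell' (hkM : ∀ i, k i * M i = L) :
    (Fintype.card (RectTorusSite k) : ℝ) * Fintype.card (RectTorusSite M) = (L : ℝ) ^ 2 := by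
  rw [card_rectTorusSite_eq_prod, card_rectTorusSite_eq_prod, Fin.prod_univ_two, Fin.prod_univ_two]
  have h : ((k 0 * M 0 : ℕ) : ℝ) * ((k 1 * M 1 : ℕ) : ℝ) = (L : ℝ) ^ 2 := by rw [hkM 0, hkM 1]; ring
  push_cast at h ⊢
  rw [← h]
  ring

/-- **The `t–t'` quasi-free certificate bound at fixed cell counts.** For real `t, t'`, `U ≥ 0`, an
`L × L` torus (`L ≥ 3`) cut into cells of sides `M i ≥ 2` (`k i · M i = L`) with NO ALIASING of the
kernel support `S` (symmetric, `0 ∈ S`), pre-shrink kernels `γ̃_σ` (zero outside `S`,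
`γ̃_σ(-R) = γ̃_σ(R)ᴴ`) whose defect kernels obey `‖d_σ(T)‖_F ≤ c_σ(T)`, and shrink parameters with
`a_σ ≥ 0`, `a_σ Σ_T c_σ(T) ≤ b_σ`, `a_σ (1 + Σ_T c_σ(T)) + b_σ ≤ 1`: the shrunk kernel
`γ_σ = a_σ γ̃_σ + b_σ δ_{R,0} 1` satisfies
`e(t,t',U; re Σ_σ tr γ_σ(0) / |cell|) ≤ re qfCellEnergyTT' t t' U γ / |cell| + (16|t| + 32|t'|)/L`.
[cite: BachLiebSolovej1994, eq. (2c.36)][cite: Lieb1981, Theorem] -/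
theorem energyDensityTT'_le_qfCellEnergyTT'_add (hkM : ∀ i, k i * M i = L) (hL : 3 ≤ L)
    (hM2 : ∀ i, 2 ≤ M i) (t t' : ℝ) {U : ℝ} (hU : 0 ≤ U) (S : Finset (Fin 2 → ℤ))
    (hS : NoAlias k S) (h0 : (0 : Fin 2 → ℤ) ∈ S) (hSneg : ∀ R ∈ S, -R ∈ S)
    (γt : Fin 2 → (Fin 2 → ℤ) → Matrix (RectTorusSite M) (RectTorusSite M) ℂ)
    (hγtS : ∀ σ, ∀ R ∉ S, γt σ R = 0) (hγt : ∀ σ R, γt σ (-R) = (γt σ R)ᴴ)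
    (c : Fin 2 → (Fin 2 → ℤ) → ℝ)
    (hc : ∀ σ, ∀ T ∈ defectSupport S, Real.sqrt (∑ i, ∑ j, ‖defectKernel S (γt σ) T i j‖ ^ 2) ≤ c σ T)
    (a b : Fin 2 → ℝ) (ha : ∀ σ, 0 ≤ a σ) (hab : ∀ σ, a σ * (∑ T ∈ defectSupport S, c σ T) ≤ b σ)
    (hab1 : ∀ σ, a σ * (1 + ∑ T ∈ defectSupport S, c σ T) + b σ ≤ 1)
    (hn0 : 0 < (∑ σ, (shrinkKernel (γt σ) (a σ) (b σ) 0).trace).re / Fintype.card (RectTorusSite M))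
    (hn2 : (∑ σ, (shrinkKernel (γt σ) (a σ) (b σ) 0).trace).re / Fintype.card (RectTorusSite M) < 2) :
    ThermodynamicLimit.energyDensityTT' t t' U
        ((∑ σ, (shrinkKernel (γt σ) (a σ) (b σ) 0).trace).re / Fintype.card (RectTorusSite M)) ≤
      (qfCellEnergyTT' t t' U (fun σ => shrinkKernel (γt σ) (a σ) (b σ))).re /
          Fintype.card (RectTorusSite M) + (16 * |t| + 32 * |t'|) / L := by
  set γ : Fin 2 → (Fin 2 → ℤ) → Matrix (RectTorusSite M) (RectTorusSite M) ℂ :=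
    fun σ => shrinkKernel (γt σ) (a σ) (b σ) with hγ
  set Q : Fin 2 → RectTorusSite k → Matrix (RectTorusSite M) (RectTorusSite M) ℂ :=
    fun σ κ => kernelBlock S (γ σ) κ with hQ
  have hγS : ∀ σ, ∀ R ∉ S, γ σ R = 0 := fun σ => shrinkKernel_eq_zero S (γt σ) h0 (hγtS σ) (a σ) (b σ)
  have hQ01 : ∀ σ κ, (Q σ κ).PosSemidef ∧ (1 - Q σ κ).PosSemidef := fun σ κ =>
    kernelBlock_shrinkKernel_posSemidef S (γt σ) h0 hSneg (hγt σ) (c σ) (hc σ) (ha σ) (hab σ) (hab1 σ) κ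
  -- the trace and the energy of the blocks
  set cK : ℂ := (Fintype.card (RectTorusSite k) : ℂ) with hcK
  have htr : ∑ σ, ∑ κ, (Q σ κ).trace = cK * ∑ σ, (γ σ 0).trace := by
    rw [Finset.mul_sum]
    exact Finset.sum_congr rfl fun σ _ => sum_trace_kernelBlock S (γ σ) hS (hγS σ)
  have hE : blochEnergyTT' t t' U Q = cK * qfCellEnergyTT' t t' U γ := by
    rw [blochEnergyTT', qfCellEnergyTT', blochEnergy_kernelBlock S hS γ hγS t U, hQ,
      blochDiag_kernelBlock S hS γ hγS]
    ring
  have hcard := card_cells_mul_card_cell' hkM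
  have hcM : (0 : ℝ) < Fintype.card (RectTorusSite M) := by exact_mod_cast Fintype.card_pos
  have hL2 : (0 : ℝ) < (L : ℝ) ^ 2 := by
    have : (0 : ℝ) < L := by exact_mod_cast (show 0 < L by omega)
    positivity
  -- `re (cK z) / L² = re z / |cell|`
  have hscale : ∀ z : ℂ, (cK * z).re / (L : ℝ) ^ 2 = z.re / Fintype.card (RectTorusSite M) := by
    intro z
    rw [hcK, show (Fintype.card (RectTorusSite k) : ℂ) = ((Fintype.card (RectTorusSite k) : ℝ) : ℂ) by
      norm_cast, Complex.re_ofReal_mul, ← hcard]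
    field_simp
  have hn_eq : (∑ σ, ∑ κ, (Q σ κ).trace).re / (L : ℝ) ^ 2 =
      (∑ σ, (γ σ 0).trace).re / Fintype.card (RectTorusSite M) := by rw [htr, hscale]
  have hE_eq : (blochEnergyTT' t t' U Q).re / (L : ℝ) ^ 2 =
      (qfCellEnergyTT' t t' U γ).re / Fintype.card (RectTorusSite M) := by rw [hE, hscale]
  have hmain := energyDensityTT'_le_blochTT'_of_posSemidef hkM hL hM2 t t' hU Q (fun σ κ => (hQ01 σ κ).1)
    (fun σ κ => (hQ01 σ κ).2) (by rw [hn_eq]; exact hn0) (by rw [hn_eq]; exact hn2)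
  rw [hn_eq, hE_eq] at hmain
  exact hmain

omit [NeZero L] [∀ i, NeZero (k i)] in
/-- **No aliasing from a support radius**: if every `R ∈ S` has `|R i| ≤ Rc i` and `k i ≥ Rc i + 2`
then `S` is not aliased by `k`. [folklore] -/
private theorem noAlias_of_radius {S : Finset (Fin 2 → ℤ)} {Rc k : Fin 2 → ℕ}
    (hRc : ∀ R ∈ S, ∀ i, |R i| ≤ Rc i) (hk : ∀ i, Rc i + 2 ≤ k i) : NoAlias k S := by
  intro R hR v hv hzero
  funext j
  have hj : ((R j - v j : ℤ) : ZMod (k j)) = 0 := by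
    have := congrFun hzero j
    simpa [cellVec] using this
  rw [ZMod.intCast_zmod_eq_zero_iff_dvd] at hj
  have habs : |R j - v j| < (k j : ℤ) := by
    have h1 := hRc R hR j
    have h2 : |v j| ≤ 1 := by rcases hv j with h | h | h <;> simp [h]
    have h3 := hk j
    calc |R j - v j| ≤ |R j| + |v j| := abs_sub _ _
      _ ≤ Rc j + 1 := by linarith
      _ < (k j : ℤ) := by exact_mod_cast (by omega : Rc j + 1 < k j)
  have := Int.eq_zero_of_abs_lt_dvd hj habs
  linarith

end Certificate

/-! ### The thermodynamic limit: the certificate's exact cell energy bounds the `t–t'` energy density -/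

section Limit

variable {M : Fin 2 → ℕ} [∀ i, NeZero (M i)]

/-- **Soundness of a translation-invariant quasi-free certificate for the `t–t'` Hubbard model.**
Cell sides `M i ≥ 2`; base cell counts `k₀ i` with `k₀ i · M i = L₀` (a square torus) and
`k₀ i ≥ Rc i + 2` (`Rc` = the support radius of `S`); kernel data EXACTLY as in the tree's
`energyDensity2D_le_qfCellEnergy` (the FORMAT-qf1 reader duties). Then, along the tori of `m k₀ i`
cells (`L = m L₀ → ∞`), for all real `t, t'` and `U ≥ 0`:
`e(t, t', U; re Σ_σ tr γ_σ(0)/|cell|) ≤ re qfCellEnergyTT' t t' U γ / |cell|`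
— the `t' = 0` theorem is the special case `qfCellEnergyTT' t 0 U = qfCellEnergy t U`.
[cite: BachLiebSolovej1994, eq. (2c.36)][cite: Lieb1981, Theorem] -/
theorem energyDensityTT'_le_qfCellEnergyTT' (hM2 : ∀ i, 2 ≤ M i) (k₀ : Fin 2 → ℕ) (L₀ : ℕ)
    (hk₀ : ∀ i, k₀ i * M i = L₀) (t t' : ℝ) {U : ℝ} (hU : 0 ≤ U) (S : Finset (Fin 2 → ℤ))
    (Rc : Fin 2 → ℕ) (hRc : ∀ R ∈ S, ∀ i, |R i| ≤ Rc i) (hkRc : ∀ i, Rc i + 2 ≤ k₀ i)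
    (h0 : (0 : Fin 2 → ℤ) ∈ S) (hSneg : ∀ R ∈ S, -R ∈ S)
    (γt : Fin 2 → (Fin 2 → ℤ) → Matrix (RectTorusSite M) (RectTorusSite M) ℂ)
    (hγtS : ∀ σ, ∀ R ∉ S, γt σ R = 0) (hγt : ∀ σ R, γt σ (-R) = (γt σ R)ᴴ)
    (c : Fin 2 → (Fin 2 → ℤ) → ℝ)
    (hc : ∀ σ, ∀ T ∈ defectSupport S, Real.sqrt (∑ i, ∑ j, ‖defectKernel S (γt σ) T i j‖ ^ 2) ≤ c σ T)
    (a b : Fin 2 → ℝ) (ha : ∀ σ, 0 ≤ a σ) (hab : ∀ σ, a σ * (∑ T ∈ defectSupport S, c σ T) ≤ b σ)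
    (hab1 : ∀ σ, a σ * (1 + ∑ T ∈ defectSupport S, c σ T) + b σ ≤ 1)
    (hn0 : 0 < (∑ σ, (shrinkKernel (γt σ) (a σ) (b σ) 0).trace).re / Fintype.card (RectTorusSite M))
    (hn2 : (∑ σ, (shrinkKernel (γt σ) (a σ) (b σ) 0).trace).re / Fintype.card (RectTorusSite M) < 2) :
    ThermodynamicLimit.energyDensityTT' t t' U
        ((∑ σ, (shrinkKernel (γt σ) (a σ) (b σ) 0).trace).re / Fintype.card (RectTorusSite M)) ≤
      (qfCellEnergyTT' t t' U (fun σ => shrinkKernel (γt σ) (a σ) (b σ))).re /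
        Fintype.card (RectTorusSite M) := by
  set E : ℝ := (qfCellEnergyTT' t t' U (fun σ => shrinkKernel (γt σ) (a σ) (b σ))).re /
    Fintype.card (RectTorusSite M) with hEdef
  set C : ℝ := 16 * |t| + 32 * |t'| with hC
  have hk₀pos : ∀ i, 0 < k₀ i := fun i => by have := hkRc i; omega
  have hL₀pos : 0 < L₀ := by
    have := hk₀ 0; have := hM2 0; have := hk₀pos 0; nlinarith
  -- the bound along `L = m L₀`, `m ≥ 3`
  have hm : ∀ m : ℕ, 3 ≤ m →
      ThermodynamicLimit.energyDensityTT' t t' U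
        ((∑ σ, (shrinkKernel (γt σ) (a σ) (b σ) 0).trace).re / Fintype.card (RectTorusSite M)) ≤
        E + C / ((m * L₀ : ℕ) : ℝ) := by
    intro m hm3
    let km : Fin 2 → ℕ := fun i => m * k₀ i
    haveI : ∀ i, NeZero (km i) := fun i => ⟨Nat.mul_ne_zero (by omega) (hk₀pos i).ne'⟩
    haveI : NeZero (m * L₀) := ⟨Nat.mul_ne_zero (by omega) hL₀pos.ne'⟩
    have hkM : ∀ i, km i * M i = m * L₀ := fun i => by
      show m * k₀ i * M i = m * L₀; rw [mul_assoc, hk₀ i]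
    have hL3 : 3 ≤ m * L₀ := le_trans hm3 (Nat.le_mul_of_pos_right m hL₀pos)
    have hS : NoAlias km S := noAlias_of_radius hRc fun i =>
      le_trans (hkRc i) (Nat.le_mul_of_pos_left (k₀ i) (by omega))
    have h := energyDensityTT'_le_qfCellEnergyTT'_add (k := km) hkM hL3 hM2 t t' hU S hS h0 hSneg γt hγtS
      hγt c hc a b ha hab hab1 hn0 hn2
    rw [hC]
    exact h
  -- `m → ∞`
  have hlim : Filter.Tendsto (fun m : ℕ => E + C / ((m * L₀ : ℕ) : ℝ)) Filter.atTop (nhds (E + 0)) := by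
    refine tendsto_const_nhds.add ?_
    have h1 : Filter.Tendsto (fun m : ℕ => ((m * L₀ : ℕ) : ℝ)) Filter.atTop Filter.atTop := by
      refine Filter.tendsto_atTop_mono (fun m => ?_) tendsto_natCast_atTop_atTop
      exact_mod_cast Nat.le_mul_of_pos_right m hL₀pos
    exact Filter.Tendsto.div_atTop tendsto_const_nhds h1
  rw [add_zero] at hlim
  exact ge_of_tendsto hlim (Filter.eventually_atTop.2 ⟨3, fun m hm3 => hm m hm3⟩)

/-- **One certificate is one cap PLANE in `(t, t', U)`.** Under the hypotheses of
`energyDensityTT'_le_qfCellEnergyTT'`, with the certificate's three exact cell numbers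
`K = re qfCellEnergy 1 0 γ / |cell|` (minus the nearest-neighbour bond sum per site),
`K_d = re qfCellDiag γ / |cell|` (the diagonal bond sum per site) and
`D = re qfCellEnergy 0 1 γ / |cell|` (the direct term per site): for ALL real `t, t'` and ALL `U ≥ 0`,
`e(t, t', U; n̄) ≤ t·K - t'·K_d + U·D` — the `t'`- and `U`-transport of a certified quasi-free upper
bound is the tangent plane of its own (affine) energy functional.
[cite: BachLiebSolovej1994, eq. (2c.36)][cite: Lieb1981, Theorem] -/
theorem energyDensityTT'_le_qfPlane (hM2 : ∀ i, 2 ≤ M i) (k₀ : Fin 2 → ℕ) (L₀ : ℕ)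
    (hk₀ : ∀ i, k₀ i * M i = L₀) (S : Finset (Fin 2 → ℤ))
    (Rc : Fin 2 → ℕ) (hRc : ∀ R ∈ S, ∀ i, |R i| ≤ Rc i) (hkRc : ∀ i, Rc i + 2 ≤ k₀ i)
    (h0 : (0 : Fin 2 → ℤ) ∈ S) (hSneg : ∀ R ∈ S, -R ∈ S)
    (γt : Fin 2 → (Fin 2 → ℤ) → Matrix (RectTorusSite M) (RectTorusSite M) ℂ)
    (hγtS : ∀ σ, ∀ R ∉ S, γt σ R = 0) (hγt : ∀ σ R, γt σ (-R) = (γt σ R)ᴴ)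
    (c : Fin 2 → (Fin 2 → ℤ) → ℝ)
    (hc : ∀ σ, ∀ T ∈ defectSupport S, Real.sqrt (∑ i, ∑ j, ‖defectKernel S (γt σ) T i j‖ ^ 2) ≤ c σ T)
    (a b : Fin 2 → ℝ) (ha : ∀ σ, 0 ≤ a σ) (hab : ∀ σ, a σ * (∑ T ∈ defectSupport S, c σ T) ≤ b σ)
    (hab1 : ∀ σ, a σ * (1 + ∑ T ∈ defectSupport S, c σ T) + b σ ≤ 1)
    {n K Kd D : ℝ} (hn0 : 0 < n) (hn2 : n < 2)
    (hn : (∑ σ, (shrinkKernel (γt σ) (a σ) (b σ) 0).trace).re / Fintype.card (RectTorusSite M) = n)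
    (hK : (qfCellEnergy 1 0 (fun σ => shrinkKernel (γt σ) (a σ) (b σ))).re /
      Fintype.card (RectTorusSite M) = K)
    (hKd : (qfCellDiag (fun σ => shrinkKernel (γt σ) (a σ) (b σ))).re /
      Fintype.card (RectTorusSite M) = Kd)
    (hD : (qfCellEnergy 0 1 (fun σ => shrinkKernel (γt σ) (a σ) (b σ))).re /
      Fintype.card (RectTorusSite M) = D)
    (t t' : ℝ) {U : ℝ} (hU : 0 ≤ U) :
    ThermodynamicLimit.energyDensityTT' t t' U n ≤ t * K - t' * Kd + U * D := by
  have h := energyDensityTT'_le_qfCellEnergyTT' hM2 k₀ L₀ hk₀ t t' hU S Rc hRc hkRc h0 hSneg γt hγtS hγt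
    c hc a b ha hab hab1 (by rw [hn]; exact hn0) (by rw [hn]; exact hn2)
  rw [hn, qfCellEnergyTT'_re] at h
  rw [← hK, ← hKd, ← hD]
  refine h.trans (le_of_eq ?_)
  ring

end Limit

end HartreeFock

end Literature.MathematicalPhysics.QuantumLattice
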